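import Summits.ABC.IUTFork.ForkBPS
import Summits.ABC.IUTFork.ForkDegrees
import Summits.ABC.IUTFork.ForkStrips
import Summits.ABC.IUTFork.ForkThm110
import Summits.ABC.IUTFork.ForkVojta

/-!
# Kernel DAG index — layer C312, part a (MACHINE DRAFT by abc-iut-dag `tools/mkkernel.py`, index v0 of plan/DAG.tsv @2026-08-25T18:35Z, 6 nodes)

THIS FILE PROVES NOTHING NEW AND ASSERTS NOTHING (plan/KERNEL-DAG-SPEC.md). It gives ONE NAME `N_<kernel_id>` to each DAG node whose
statement has LANDED through the gate, knitting the landed declarations BY NAME; `N_<id>_holds` exists iff the node's printed claims are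
theorems OUR kernel checked (it IS those theorems); FACT-style `def … : Prop` claims and `@[claim … "disputed"]` items get a name and no
`_holds`. Nothing here says abc is proved or refuted or takes a side on [IUTchIII] Cor 3.12. typed ≠ discharged; indexed ≠ endorsed.
Filer of the tree copy: abc-iut-c312-2 (`Summits/ABC/IUTFork/DAGC312a.lean`); this draft is regenerated hourly and is not the tree.
FILED COPY (abc-iut-c312-2, post-processed by work/fixdraft.py): claim nodes are claim-form abbrevs without `_holds`;
`_holds` only for DAG rows marked discharged, `_part` otherwise (spec §2(b),(c)); edges by name (§3).
-/

namespace Summit.ABC.IUTFork.DAG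

namespace PartC312a
/-- `StatementOf h` is the statement (a `Prop`) of which the landed `h` is the proof: the index NAMES statements, it never re-types them. -/
abbrev StatementOf {P : Prop} (_h : P) : Prop := P
end PartC312a
open PartC312a

noncomputable section
universe u₁ u₂ u₃ u₄ u₅ u₆ u₇ u₈ u₉

/-- [node IUTchIII:Cor3.12 · C312/D4 · [IUTchIII] Cor 3.12, kurims pp.173–174 · claim-form (skel III `Thm110Data.Cor312`,
p403253; region/volume-level forms: skel XVII `Cor312Setting.Cor312`, c312-2 `Cor312Proof.Volumes.Cor312` — knitted when built)]
"`−|log(Θ)| ∈ ℝ` and `−|log(Θ)| ≥ −|log(q)|`" for the Thm-1.10 numbers of one curve. CLAIM-FORM: a name, NO `_holds` (the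
tree does not prove it; `@[claim "Mochizuki2012" "disputed"]` in the home file). cites→ IUTchIII:Def3.8, Prop3.9, Rmk3.1.1,
Rmk3.9.5, Thm3.11 -/
abbrev N_IUTchIII_Cor3_12 (X : Summit.ABC.IUTFork.Thm110Data) : Prop := X.Cor312
example := @Summit.ABC.IUTFork.Thm110Data.MultiradialEstimate
/-- [node Fork:ForkBPS · C312/D4 · HOME/skel/ForkBPS.lean (400 lines; 6 structures / 12 defs / 21 theorem · p403268 · claim] decls 39 · cites→ - -/
def N_Fork_ForkBPS : Prop :=
  StatementOf @Summit.ABC.IUTFork.PointedLine.Iso.ext' ∧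
  StatementOf @Summit.ABC.IUTFork.PointedLine.exists_smul_pilot ∧
  StatementOf @Summit.ABC.IUTFork.PointedLine.iso_nonempty ∧
  StatementOf @Summit.ABC.IUTFork.PointedLine.iso_subsingleton ∧
  StatementOf @Summit.ABC.IUTFork.ValueGroupBPS.comb_apply ∧
  StatementOf @Summit.ABC.IUTFork.ValueGroupBPS.comb_single ∧
  StatementOf @Summit.ABC.IUTFork.ValueGroupBPS.mem_PF ∧
  StatementOf @Summit.ABC.IUTFork.ValueGroupBPS.bad_nonempty ∧
  StatementOf @Summit.ABC.IUTFork.ValueGroupBPS.comb_surjective ∧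
  StatementOf @Summit.ABC.IUTFork.ValueGroupBPS.Iso.ext' ∧
  StatementOf @Summit.ABC.IUTFork.ValueGroupBPS.Iso.apply_comb ∧
  StatementOf @Summit.ABC.IUTFork.ValueGroupBPS.Iso.map_pilot
/-- partial witness (DAG row not marked discharged) of `N_Fork_ForkBPS`: the landed theorems it names, BY NAME (spec §2(c)); proves nothing new. -/
theorem N_Fork_ForkBPS_part : N_Fork_ForkBPS := ⟨@Summit.ABC.IUTFork.PointedLine.Iso.ext', @Summit.ABC.IUTFork.PointedLine.exists_smul_pilot, @Summit.ABC.IUTFork.PointedLine.iso_nonempty, @Summit.ABC.IUTFork.PointedLine.iso_subsingleton, @Summit.ABC.IUTFork.ValueGroupBPS.comb_apply, @Summit.ABC.IUTFork.ValueGroupBPS.comb_single, @Summit.ABC.IUTFork.ValueGroupBPS.mem_PF, @Summit.ABC.IUTFork.ValueGroupBPS.bad_nonempty, @Summit.ABC.IUTFork.ValueGroupBPS.comb_surjective, @Summit.ABC.IUTFork.ValueGroupBPS.Iso.ext', @Summit.ABC.IUTFork.ValueGroupBPS.Iso.apply_comb, @Summit.ABC.IUTFork.ValueGroupBPS.Is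o.map_pilot⟩
-- (+9 further theorems of this node not conjoined in the draft)
example := @Summit.ABC.IUTFork.PointedLine
example := @Summit.ABC.IUTFork.PointedLine.Iso
example := @Summit.ABC.IUTFork.ValueGroupBPS
example := @Summit.ABC.IUTFork.ValueGroupBPS.pilot
example := @Summit.ABC.IUTFork.ValueGroupBPS.comb
example := @Summit.ABC.IUTFork.ValueGroupBPS.PF

/-- [node Fork:ForkDegrees · C312/D4 · HOME/skel/ForkDegrees.lean (400 lines; 1 structures / 9 defs / 24 theo · p403649 · claim] decls 32 · cites→ - -/
def N_Fork_ForkDegrees : Prop :=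
  StatementOf @Summit.ABC.IUTFork.PilotDegrees.lstar_pos ∧
  StatementOf @Summit.ABC.IUTFork.PilotDegrees.l_cast ∧
  StatementOf @Summit.ABC.IUTFork.PilotDegrees.l_pos ∧
  StatementOf @Summit.ABC.IUTFork.PilotDegrees.thetaVol_eq ∧
  StatementOf @Summit.ABC.IUTFork.PilotDegrees.avgWeight_unitWeights ∧
  StatementOf @Summit.ABC.IUTFork.PilotDegrees.avgWeight_sqWeights ∧
  StatementOf @Summit.ABC.IUTFork.PilotDegrees.thetaVol_sqWeights ∧
  StatementOf @Summit.ABC.IUTFork.PilotDegrees.thetaVol_unitWeights ∧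
  StatementOf @Summit.ABC.IUTFork.PilotDegrees.ineq_iff_avgWeight ∧
  StatementOf @Summit.ABC.IUTFork.PilotDegrees.ineq_unitWeights_iff ∧
  StatementOf @Summit.ABC.IUTFork.PilotDegrees.ineq_unitWeights ∧
  StatementOf @Summit.ABC.IUTFork.PilotDegrees.one_sub_twelve_div_pos
/-- partial witness (DAG row not marked discharged) of `N_Fork_ForkDegrees`: the landed theorems it names, BY NAME (spec §2(c)); proves nothing new. -/
theorem N_Fork_ForkDegrees_part : N_Fork_ForkDegrees := ⟨@Summit.ABC.IUTFork.PilotDegrees.lstar_pos, @Summit.ABC.IUTFork.PilotDegrees.l_cast, @Summit.ABC.IUTFork.PilotDegrees.l_pos, @Summit.ABC.IUTFork.PilotDegrees.thetaVol_eq, @Summit.ABC.IUTFork.PilotDegrees.avgWeight_unitWeights, @Summit.ABC.IUTFork.PilotDegrees.avgWeight_sqWeights, @Summit.ABC.IUTFork.PilotDegrees.thetaVol_sqWeights, @Summit.ABC.IUTFork.PilotDegrees.thetaVol_unitWeights, @Summit.ABC.IUTFork.PilotDegrees.ineq_iff_avgWeight, @Summit.ABC.IUTFork.PilotDegrees.ineq_unitWeights_iff,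 @Summit.ABC.IUTFork.PilotDegrees.ineq_unitWeights, @Summit.ABC.IUTFork.PilotDegrees.one_sub_twelve_div_pos⟩
-- (+10 further theorems of this node not conjoined in the draft)
example := @Summit.ABC.IUTFork.PilotDegrees
example := @Summit.ABC.IUTFork.PilotDegrees.l
example := @Summit.ABC.IUTFork.PilotDegrees.negAbsLogq
example := @Summit.ABC.IUTFork.PilotDegrees.thetaVol
example := @Summit.ABC.IUTFork.PilotDegrees.Ineq
example := @Summit.ABC.IUTFork.PilotDegrees.avgWeight

/-- [node Fork:ForkStrips · C312/D4 · HOME/skel/ForkStrips.lean (163 lines; 1 structures / 4 defs / 6 theore · p403256 · claim] decls 11 · cites→ - -/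
def N_Fork_ForkStrips : Prop :=
  StatementOf @Summit.ABC.IUTFork.addEquiv_nat_eq_refl ∧
  StatementOf @Summit.ABC.IUTFork.subsingleton_addEquiv_nat ∧
  StatementOf @Summit.ABC.IUTFork.ConcreteStrip.abstractLink_forgets ∧
  StatementOf @Summit.ABC.IUTFork.ConcreteStrip.abstractLink_of_ne_embeddings ∧
  StatementOf @Summit.ABC.IUTFork.thetaStrip_gen ∧
  StatementOf @Summit.ABC.IUTFork.thetaStrip_gen_ne_qStrip_gen
/-- partial witness (DAG row not marked discharged) of `N_Fork_ForkStrips`: the landed theorems it names, BY NAME (spec §2(c)); proves nothing new. -/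
theorem N_Fork_ForkStrips_part : N_Fork_ForkStrips := ⟨@Summit.ABC.IUTFork.addEquiv_nat_eq_refl, @Summit.ABC.IUTFork.subsingleton_addEquiv_nat, @Summit.ABC.IUTFork.ConcreteStrip.abstractLink_forgets, @Summit.ABC.IUTFork.ConcreteStrip.abstractLink_of_ne_embeddings, @Summit.ABC.IUTFork.thetaStrip_gen, @Summit.ABC.IUTFork.thetaStrip_gen_ne_qStrip_gen⟩
example := @Summit.ABC.IUTFork.ConcreteStrip
example := @Summit.ABC.IUTFork.ConcreteStrip.emb
example := @Summit.ABC.IUTFork.ConcreteStrip.AbstractLink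
example := @Summit.ABC.IUTFork.qStrip
example := @Summit.ABC.IUTFork.thetaStrip

/-- [node Fork:ForkThm110 · C312/D4 · HOME/skel/ForkThm110.lean (234 lines; 1 structures / 6 defs / 6 theore · p403253 · claim] decls 13 · cites→ - -/
def N_Fork_ForkThm110 : Prop :=
  StatementOf @Summit.ABC.IUTFork.Thm110Data.absLogq_pos ∧
  StatementOf @Summit.ABC.IUTFork.Thm110Data.neg_one_le_CTheta ∧
  StatementOf @Summit.ABC.IUTFork.Thm110Data.bracket_nonneg_of_neg_one_le_CTheta ∧
  StatementOf @Summit.ABC.IUTFork.Thm110Data.thm110_display ∧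
  StatementOf @Summit.ABC.IUTFork.Thm110Data.coeff_step_fails_at_five ∧
  StatementOf @Summit.ABC.IUTFork.Thm110Data.display_of_cor312
/-- partial witness (DAG row not marked discharged) of `N_Fork_ForkThm110`: the landed theorems it names, BY NAME (spec §2(c)); proves nothing new. -/
theorem N_Fork_ForkThm110_part : N_Fork_ForkThm110 := ⟨@Summit.ABC.IUTFork.Thm110Data.absLogq_pos, @Summit.ABC.IUTFork.Thm110Data.neg_one_le_CTheta, @Summit.ABC.IUTFork.Thm110Data.bracket_nonneg_of_neg_one_le_CTheta, @Summit.ABC.IUTFork.Thm110Data.thm110_display, @Summit.ABC.IUTFork.Thm110Data.coeff_step_fails_at_five, @Summit.ABC.IUTFork.Thm110Data.display_of_cor312⟩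
example := @Summit.ABC.IUTFork.Thm110Data
example := @Summit.ABC.IUTFork.Thm110Data.absLogq
example := @Summit.ABC.IUTFork.Thm110Data.bracket
example := @Summit.ABC.IUTFork.Thm110Data.CTheta
example := @Summit.ABC.IUTFork.Thm110Data.MultiradialEstimate
example := @Summit.ABC.IUTFork.Thm110Data.Cor312

/-- [node Fork:ForkVojta · C312/D4 · HOME/skel/ForkVojta.lean (299 lines; 1 structures / 2 defs / 3 theorem · p403254 · claim] decls 6 · cites→ - -/
def N_Fork_ForkVojta : Prop :=
  StatementOf @Summit.ABC.IUTFork.HeightFamily.growth_aux ∧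
  StatementOf @Summit.ABC.IUTFork.HeightFamily.vojtaShape_of_claim6 ∧
  StatementOf @Summit.ABC.IUTFork.HeightFamily.claim6_of_thm110
/-- partial witness (DAG row not marked discharged) of `N_Fork_ForkVojta`: the landed theorems it names, BY NAME (spec §2(c)); proves nothing new. -/
theorem N_Fork_ForkVojta_part : N_Fork_ForkVojta := ⟨@Summit.ABC.IUTFork.HeightFamily.growth_aux, @Summit.ABC.IUTFork.HeightFamily.vojtaShape_of_claim6, @Summit.ABC.IUTFork.HeightFamily.claim6_of_thm110⟩
example := @Summit.ABC.IUTFork.HeightFamily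
example := @Summit.ABC.IUTFork.HeightFamily.Claim6
example := @Summit.ABC.IUTFork.HeightFamily.VojtaShape

end

end Summit.ABC.IUTFork.DAG
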